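import Literature.IUT.LogVolume.TameRamificationIndex
import Literature.IUT.LogVolume.LocalFieldTraceRetraction
import Literature.IUT.LogVolume.FundamentalIdentity
import Mathlib.NumberTheory.Padics.RingHoms
import HarnessLib

/-!
# The trace-zero part of `𝔪_K` (and of `log_p(R^×)` at a tame field) is CO-RADIAL: it contains an element of maximal norm
# (Serre, *Local Fields* III §3; [IUTchIV] Prop. 1.2 (i))

abc-iut cell, PROOF-ONLY classical local algebra (Cor. 3.12 sub-crew, seat abc-iut-c312-1 gen 15, row «R19 HULL-WASHOUT», file 1/3;
no definition, no `Prop` fact).  Setting: a `p`-adic field `K` in the campaign-S class (nontrivially normed, normed `ℚ_p`-algebra,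
ultrametric, proper), `e = absRamificationIdx p K`, `f = residueDegree p K`, `e·f = [K:ℚ_p]` (`absRamificationIdx_mul_residueDegree`).

WHY (the consumer, `Summits/ABC/IUTFork/Thm311RealInd1StripOrbitHull`): at one place the holomorphic hull of a bounded region is the ball
of its sup-norm ([IUTchIII] Rmk. 3.9.5; tree `holomorphicHull`), and the additive span of the orbit of a region `M ⊆ c·log_p(𝒪_v^×)` under
print's (Ind1)⊔(Ind2) as typed by this lineage lies in — and for general-position regions, modulo the Jannsen–Wingberg facts, equals —
`M + c·(log_p(𝒪_v^×) ∩ Ker Tr_{K_v/ℚ_p})` (p516833 §1 / p524057), whereas Dupuy–Hilado's container generates `c·log_p(𝒪_v^×)` (abc-iut-w5-d180).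
The two have THE SAME hull iff the trace-zero sublattice `log_p(𝒪_v^×) ∩ Ker Tr` contains an element of maximal norm of `log_p(𝒪_v^×)`.
THIS FILE proves that it does at every tamely ramified field of degree `≥ 2`:

* `exists_trace_eq_zero_norm_eq_of_two_le_absRamificationIdx` — `e ≥ 2`, `p ∤ e`: `w := ϖ − Tr(ϖ)·z₁` with `Tr z₁ = 1`, `‖z₁‖ ≤ 1`
  (`TameRamification.exists_trace_eq_one_iff_not_dvd_absRamificationIdx`) has `Tr w = 0` and `‖w‖ = ‖ϖ‖ = p^{−1/e}`
  (`‖Tr ϖ‖ ≤ p⁻¹ < p^{−1/e}`, ultrametric equality);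
* `exists_trace_eq_zero_norm_eq_of_absRamificationIdx_eq_one` — `e = 1` (unramified), `[K:ℚ_p] ≥ 2`: `w := p·(x − Tr(x)·z₁)` for an
  integer `x` with `‖x − Tr(x)·z₁‖ = 1`; such an `x` exists, for otherwise every residue class of `𝒪_K/𝔪` is `[n·z₁]` with `0 ≤ n < p`
  (`PadicInt.exists_mem_range`), so `p^f = #(𝒪_K/𝔪) ≤ p`, contradicting `f = [K:ℚ_p] ≥ 2`;
* `exists_trace_eq_zero_isMaxOn_norm_lt_one` — hence for `p ∤ e`, `[K:ℚ_p] ≥ 2`: some `w` with `Tr w = 0`, `‖w‖ < 1` has `‖z‖ ≤ ‖w‖`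
  for EVERY `z` with `‖z‖ < 1` (the trace-zero part of `𝔪_K` is co-radial in `𝔪_K`);
* `exists_mem_logUnits_trace_eq_zero_isMaxOn_of_tame` — at a TAME field in the sense of [IUTchIV] Prop. 1.2 (i) (`p > 2`, `e ≤ p − 2`,
  so `log_p(R^×) = 𝔪_K`, abc-iut-w5-d036 `mem_logUnits_iff_norm_lt_one_of_tame`) of degree `≥ 2`: some `w ∈ log_p(R^×) ∩ Ker Tr` has
  maximal norm in `log_p(R^×)`;
* (sharpness, recorded in the consumer file) at `[K:ℚ_p] = 1` the trace is injective, so the trace-zero part is `{0}` — no co-radiality;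
  there print's (Ind1) strip part is trivial anyway (this lineage p453109).

HONEST SCOPE: classical; wildly ramified fields are NOT treated (co-radiality can fail there, e.g. `ℚ₂(√−1)`: `𝔪 ∩ Ker Tr = 2ℤ₂·√−1 ⊆ 𝔪²`);
nothing here mentions a hull, a packet or a log-volume; no side taken on [IUTchIII] Cor. 3.12; NO abc claim.
[cite: SerreLocalFields1979, Ch. III §3, Prop. 7; §6, Prop. 13] [cite: NeukirchANT1999, Ch. II (4.8)] [cite: Mochizuki2012, IUTchIV Prop. 1.2 (i) p. 10]
-/

set_option autoImplicit false

noncomputable section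

open Module IsLocalRing
open scoped NormedField

namespace Literature.IUT.LogVolume

namespace TraceZeroCoradial

open Literature.NumberTheory.GaloisRepresentations.Ultrametric TameRamification

variable {p : ℕ} [Fact p.Prime]
variable {K : Type} [NontriviallyNormedField K] [NormedAlgebra ℚ_[p] K] [IsUltrametricDist K] [ProperSpace K]

/-! ## §1 `e ≥ 2`, tame: `ϖ − Tr(ϖ)·z₁` -/

variable (p) in
/-- A `p`-adic number of norm `< 1` has norm `≤ p⁻¹` (the value group of `ℚ_p` is `p^ℤ`). [folklore] -/
private theorem padic_norm_le_inv_of_norm_lt_one {a : ℚ_[p]} (ha : ‖a‖ < 1) : ‖a‖ ≤ (p : ℝ)⁻¹ := by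
  have h := (Padic.norm_le_pow_iff_norm_lt_pow_add_one a (-1)).mpr (by simpa using ha)
  simpa using h

omit [NormedAlgebra ℚ_[p] K] [ProperSpace K] in
/-- Ultrametric inequality for differences: `‖x − y‖ ≤ max ‖x‖ ‖y‖`. [folklore] -/
private theorem norm_sub_le_max' (x y : K) : ‖x - y‖ ≤ max ‖x‖ ‖y‖ := by
  rw [sub_eq_add_neg, ← norm_neg y]
  exact IsUltrametricDist.norm_add_le_max x (-y)

variable (p K) in
/-- **Tamely ramified with `e ≥ 2` ⇒ a trace-zero element of uniformizer norm.**  If `p ∤ e = e(K/ℚ_p)` and `e ≥ 2`, there is `w ∈ K`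
with `Tr_{K/ℚ_p}(w) = 0` and `‖w‖ = p^{−1/e}` (`= ‖ϖ‖`, the largest norm `< 1`): `w = ϖ − Tr(ϖ)·z₁` where `‖z₁‖ ≤ 1`, `Tr z₁ = 1`
(tameness), since `‖Tr(ϖ)·z₁‖ ≤ ‖Tr ϖ‖ ≤ p⁻¹ < p^{−1/e}`. [cite: SerreLocalFields1979, Ch. III §6, Prop. 13] [cite: NeukirchANT1999, Ch. II (4.8)] -/
theorem exists_trace_eq_zero_norm_eq_of_two_le_absRamificationIdx (h2 : 2 ≤ absRamificationIdx p K)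
    (hnd : ¬ p ∣ absRamificationIdx p K) :
    ∃ w : K, Algebra.trace ℚ_[p] K w = 0 ∧ ‖w‖ = (p : ℝ) ^ (-(1 / (absRamificationIdx p K : ℝ))) := by
  obtain ⟨z₁, hz₁, htr₁⟩ := (exists_trace_eq_one_iff_not_dvd_absRamificationIdx p K).mpr hnd
  have hp1 : (1 : ℝ) < p := by exact_mod_cast (Fact.out : p.Prime).one_lt
  have he0 : (0 : ℝ) < absRamificationIdx p K := by exact_mod_cast absRamificationIdx_pos p K
  set ϖ : Kˣ := unifChoice K with hϖdef
  have hϖ : ‖(ϖ : K)‖ = (p : ℝ) ^ (-(1 / (absRamificationIdx p K : ℝ))) :=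
    norm_eq_rpow_of_isUniformizer p K (isUniformizer_unifChoice K)
  have hϖ1 : ‖(ϖ : K)‖ < 1 := by
    rw [hϖ]
    exact Real.rpow_lt_one_of_one_lt_of_neg hp1 (by
      have : 0 < 1 / (absRamificationIdx p K : ℝ) := by positivity
      linarith)
  set a : ℚ_[p] := Algebra.trace ℚ_[p] K (ϖ : K) with ha
  have ha1 : ‖a‖ ≤ (p : ℝ)⁻¹ :=
    padic_norm_le_inv_of_norm_lt_one p ((norm_trace_le_norm (p := p) (ϖ : K)).trans_lt hϖ1)
  -- `p⁻¹ < p^{-1/e}` because `e ≥ 2`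
  have hlt' : (p : ℝ)⁻¹ < (p : ℝ) ^ (-(1 / (absRamificationIdx p K : ℝ))) := by
    rw [← Real.rpow_neg_one]
    refine (Real.rpow_lt_rpow_left_iff hp1).mpr ?_
    have h2' : (2 : ℝ) ≤ absRamificationIdx p K := by exact_mod_cast h2
    have : 1 / (absRamificationIdx p K : ℝ) ≤ 1 / 2 := by
      rw [one_div_le_one_div he0 (by norm_num)]
      exact h2'
    linarith
  refine ⟨(ϖ : K) - a • z₁, ?_, ?_⟩
  · rw [map_sub, map_smul, htr₁, smul_eq_mul, mul_one, ha, sub_self]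
  · have hlt : ‖a • z₁‖ < ‖(ϖ : K)‖ := by
      calc ‖a • z₁‖ = ‖a‖ * ‖z₁‖ := norm_smul a z₁
        _ ≤ (p : ℝ)⁻¹ * 1 := mul_le_mul ha1 hz₁ (norm_nonneg _) (by positivity)
        _ < ‖(ϖ : K)‖ := by rw [mul_one, hϖ]; exact hlt'
    rw [sub_eq_add_neg, IsUltrametricDist.norm_add_eq_max_of_norm_ne_norm (by rw [norm_neg]; exact hlt.ne'),
      norm_neg, max_eq_left hlt.le, hϖ]

/-! ## §2 `e = 1` (unramified), degree `≥ 2`: `p·(x − Tr(x)·z₁)` -/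

variable (p K) in
/-- **Unramified of degree `≥ 2` ⇒ a trace-zero UNIT, hence a trace-zero element of norm `p⁻¹`.**  If `e(K/ℚ_p) = 1` and `[K:ℚ_p] ≥ 2`
there is `w ∈ K` with `Tr_{K/ℚ_p}(w) = 0` and `‖w‖ = p⁻¹` (`= ‖ϖ‖`).  Proof: with `Tr z₁ = 1`, `‖z₁‖ ≤ 1` some integer `x` has
`‖x − Tr(x)·z₁‖ = 1` — otherwise every class of `𝒪_K/𝔪` is `[n·z₁]`, `0 ≤ n < p` (`Tr x ∈ ℤ_p ≡ n mod p`), so `p^f = #(𝒪_K/𝔪) ≤ p`, against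
`f = [K:ℚ_p] ≥ 2` (`e·f = [K:ℚ_p]`); then `w = p·(x − Tr(x)·z₁)`. [cite: SerreLocalFields1979, Ch. III §5, Thm. 2; Ch. I §6] -/
theorem exists_trace_eq_zero_norm_eq_of_absRamificationIdx_eq_one (he : absRamificationIdx p K = 1)
    (hd : 2 ≤ finrank ℚ_[p] K) :
    ∃ w : K, Algebra.trace ℚ_[p] K w = 0 ∧ ‖w‖ = (p : ℝ)⁻¹ := by
  have hP : p.Prime := Fact.out
  have hnd : ¬ p ∣ absRamificationIdx p K := by
    rw [he, Nat.dvd_one]; exact hP.one_lt.ne'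
  obtain ⟨z₁, hz₁, htr₁⟩ := (exists_trace_eq_one_iff_not_dvd_absRamificationIdx p K).mpr hnd
  -- abbreviation: the trace-zero projection `x ↦ x − Tr(x)·z₁`
  have hproj_tr : ∀ x : K, Algebra.trace ℚ_[p] K (x - Algebra.trace ℚ_[p] K x • z₁) = 0 := by
    intro x; rw [map_sub, map_smul, htr₁, smul_eq_mul, mul_one, sub_self]
  have hproj_le : ∀ x : K, ‖x‖ ≤ 1 → ‖x - Algebra.trace ℚ_[p] K x • z₁‖ ≤ 1 := by
    intro x hx
    refine (norm_sub_le_max' _ _).trans (max_le hx ?_)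
    rw [norm_smul]
    calc ‖Algebra.trace ℚ_[p] K x‖ * ‖z₁‖ ≤ ‖x‖ * 1 :=
          mul_le_mul (norm_trace_le_norm (p := p) x) hz₁ (norm_nonneg _) (norm_nonneg _)
      _ ≤ 1 := by rw [mul_one]; exact hx
  -- the key step: some integer has a trace-zero projection of norm EXACTLY `1`
  have key : ∃ x : K, ‖x‖ ≤ 1 ∧ ‖x - Algebra.trace ℚ_[p] K x • z₁‖ = 1 := by
    by_contra hcon
    push Not at hcon
    have hlt : ∀ x : K, ‖x‖ ≤ 1 → ‖x - Algebra.trace ℚ_[p] K x • z₁‖ < 1 :=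
      fun x hx => lt_of_le_of_ne (hproj_le x hx) (hcon x hx)
    -- residue count
    let O := Valued.integer K
    let z₁' : O := ⟨z₁, Valued.integer.mem_iff.mpr hz₁⟩
    haveI : Finite (O ⧸ maximalIdeal O) := (finite_residueField : Finite (ResidueField O))
    have hsurj : Function.Surjective
        (fun n : Fin p => Ideal.Quotient.mk (maximalIdeal O) (((n : ℕ) : O) * z₁')) := by
      intro q
      obtain ⟨x', rfl⟩ := Ideal.Quotient.mk_surjective q
      have hx' : ‖(x' : K)‖ ≤ 1 := Valued.integer.mem_iff.mp x'.2
      -- `Tr x' ∈ ℤ_p`, `≡ n (mod p)` for some `n < p`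
      set t : ℚ_[p] := Algebra.trace ℚ_[p] K (x' : K) with ht
      have ht1 : ‖t‖ ≤ 1 := (norm_trace_le_norm (p := p) (x' : K)).trans hx'
      obtain ⟨n, hnp, hn⟩ := PadicInt.exists_mem_range (⟨t, ht1⟩ : ℤ_[p])
      refine ⟨⟨n, hnp⟩, ?_⟩
      change Ideal.Quotient.mk (maximalIdeal O) (((n : ℕ) : O) * z₁') = Ideal.Quotient.mk (maximalIdeal O) x'
      rw [Ideal.Quotient.eq, mem_maximalIdeal_iff_norm_lt_one]
      have hnz : ((n : ℚ_[p]) • z₁ : K) = (n : K) * z₁ := by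
        rw [Algebra.smul_def, map_natCast]
      have hval : (((((n : ℕ) : O) * z₁' - x' : O) : K)) = -(((x' : K) - t • z₁) + (t - (n : ℚ_[p])) • z₁) := by
        have hc : (((((n : ℕ) : O) * z₁' - x' : O) : K)) = (n : K) * z₁ - (x' : K) := by push_cast; rfl
        rw [hc, sub_smul, hnz]
        ring
      change ‖((((n : ℕ) : O) * z₁' - x' : O) : K)‖ < 1
      rw [hval, norm_neg]
      refine lt_of_le_of_lt (IsUltrametricDist.norm_add_le_max _ _) (max_lt (hlt _ hx') ?_)
      rw [norm_smul]
      have htn : ‖t - (n : ℚ_[p])‖ < 1 := by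
        have h := hn
        rw [IsLocalRing.mem_maximalIdeal, PadicInt.mem_nonunits, PadicInt.norm_def, PadicInt.coe_sub,
          PadicInt.coe_natCast] at h
        exact h
      calc ‖t - (n : ℚ_[p])‖ * ‖z₁‖ ≤ ‖t - (n : ℚ_[p])‖ * 1 :=
            mul_le_mul_of_nonneg_left hz₁ (norm_nonneg _)
        _ < 1 := by rw [mul_one]; exact htn
    have hcard : Nat.card (O ⧸ maximalIdeal O) ≤ p := by
      have h := Nat.card_le_card_of_surjective _ hsurj
      simpa using h
    -- `#(𝒪/𝔪) = p^f`, `f = [K:ℚ_p] ≥ 2`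
    have hf : residueDegree p K = finrank ℚ_[p] K := by
      have h := absRamificationIdx_mul_residueDegree p K
      rwa [he, one_mul] at h
    have hcardK : Nat.card (O ⧸ maximalIdeal O) = p ^ residueDegree p K := card_residueField p K
    rw [hcardK, hf] at hcard
    have : p ^ 2 ≤ p ^ 1 := by
      rw [pow_one]
      exact (Nat.pow_le_pow_right hP.pos hd).trans hcard
    have h' := (Nat.pow_le_pow_iff_right hP.one_lt).mp this
    omega
  obtain ⟨x, hx, hk⟩ := key
  refine ⟨(p : ℚ_[p]) • (x - Algebra.trace ℚ_[p] K x • z₁), ?_, ?_⟩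
  · rw [map_smul, hproj_tr, smul_zero]
  · rw [norm_smul, hk, mul_one, Padic.norm_p]

/-! ## §3 The trace-zero part of `𝔪_K`, and of `log_p(R^×)` at a tame field, is co-radial -/

variable (p K) in
/-- **`𝔪_K ∩ Ker(Tr)` is CO-RADIAL in `𝔪_K`** for `p ∤ e(K/ℚ_p)` and `[K:ℚ_p] ≥ 2`: some `w` with `Tr_{K/ℚ_p}(w) = 0`, `‖w‖ < 1` satisfies
`‖z‖ ≤ ‖w‖` for every `z` with `‖z‖ < 1` (namely `‖w‖ = p^{−1/e} = ‖ϖ‖`; §1 for `e ≥ 2`, §2 for `e = 1`, where `f = [K:ℚ_p] ≥ 2`).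
[cite: SerreLocalFields1979, Ch. III §6, Prop. 13] -/
theorem exists_trace_eq_zero_isMaxOn_norm_lt_one (hnd : ¬ p ∣ absRamificationIdx p K) (hd : 2 ≤ finrank ℚ_[p] K) :
    ∃ w : K, Algebra.trace ℚ_[p] K w = 0 ∧ ‖w‖ < 1 ∧
      ‖w‖ = (p : ℝ) ^ (-(1 / (absRamificationIdx p K : ℝ))) ∧ ∀ z : K, ‖z‖ < 1 → ‖z‖ ≤ ‖w‖ := by
  have hp1 : (1 : ℝ) < p := by exact_mod_cast (Fact.out : p.Prime).one_lt
  have hwlt : (p : ℝ) ^ (-(1 / (absRamificationIdx p K : ℝ))) < 1 :=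
    Real.rpow_lt_one_of_one_lt_of_neg hp1 (by
      have : 0 < 1 / (absRamificationIdx p K : ℝ) := by
        have := absRamificationIdx_pos p K; positivity
      linarith)
  rcases Nat.lt_or_ge (absRamificationIdx p K) 2 with h1 | h2
  · -- `e = 1`
    have he : absRamificationIdx p K = 1 := by have := absRamificationIdx_pos p K; omega
    obtain ⟨w, htr, hw⟩ := exists_trace_eq_zero_norm_eq_of_absRamificationIdx_eq_one p K he hd
    have hw' : ‖w‖ = (p : ℝ) ^ (-(1 / (absRamificationIdx p K : ℝ))) := by
      rw [hw, he, Nat.cast_one, div_one, Real.rpow_neg_one]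
    exact ⟨w, htr, hw' ▸ hwlt, hw', fun z hz => hw' ▸ norm_le_rpow_of_norm_lt_one p K hz⟩
  · obtain ⟨w, htr, hw⟩ := exists_trace_eq_zero_norm_eq_of_two_le_absRamificationIdx p K h2 hnd
    exact ⟨w, htr, hw ▸ hwlt, hw, fun z hz => hw ▸ norm_le_rpow_of_norm_lt_one p K hz⟩

variable (p K) in
/-- **At a TAME field of degree `≥ 2`, `log_p(R^×) ∩ Ker(Tr)` is CO-RADIAL in `log_p(R^×)`**: for `p > 2`, `e ≤ p − 2` ([IUTchIV] Prop. 1.2 (i):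
`log_p(R^×) = 𝔪_K`, abc-iut-w5-d036 `mem_logUnits_iff_norm_lt_one_of_tame`) and `[K:ℚ_p] ≥ 2`, some `w ∈ log_p(R^×)` with
`Tr_{K/ℚ_p}(w) = 0` has `‖z‖ ≤ ‖w‖` for every `z ∈ log_p(R^×)` (and `‖w‖ = p^{−1/e}`).  So the sup-norm — the single-place holomorphic-hull
radius — of the trace-zero sublattice equals that of `log_p(R^×)` itself. [cite: Mochizuki2012, IUTchIV Prop. 1.2 (i) p. 10]
[cite: SerreLocalFields1979, Ch. III §6, Prop. 13] [claim: Mochizuki2012, status: disputed] -/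
theorem exists_mem_logUnits_trace_eq_zero_isMaxOn_of_tame (hp : 2 < p) (he : absRamificationIdx p K ≤ p - 2)
    (hd : 2 ≤ finrank ℚ_[p] K) :
    ∃ w : K, w ∈ logUnits K ∧ Algebra.trace ℚ_[p] K w = 0 ∧
      ‖w‖ = (p : ℝ) ^ (-(1 / (absRamificationIdx p K : ℝ))) ∧ ∀ z ∈ logUnits K, ‖z‖ ≤ ‖w‖ := by
  have hnd : ¬ p ∣ absRamificationIdx p K := by
    intro h
    have := Nat.le_of_dvd (absRamificationIdx_pos p K) h
    omega
  obtain ⟨w, htr, hw1, hw, hmax⟩ := exists_trace_eq_zero_isMaxOn_norm_lt_one p K hnd hd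
  refine ⟨w, (mem_logUnits_iff_norm_lt_one_of_tame p hp he w).mpr hw1, htr, hw, fun z hz => ?_⟩
  exact hmax z ((mem_logUnits_iff_norm_lt_one_of_tame p hp he z).mp hz)

end TraceZeroCoradial

end Literature.IUT.LogVolume

end
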